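import Literature.NumberTheory.EllipticCurves.Milne1972.WeilRestrictionQuadraticBSDQuotientAnyModel
import Mathlib.FieldTheory.Galois.Basic
import HarnessLib

/-!
# The `S₃` Brauer relation of a cubic field and its quadratic resolvent: Artin formalism for
# `L(E/·, s)`, the Birch–Swinnerton-Dyer quotient relation (Dokchitser–Dokchitser 2010, Thm. 2.3),
# and the entire continuation of `L(E/F, s)`, `L(E/L, s)` (base change for `GL(2)`)

Topic `Literature/NumberTheory/EllipticCurves`. Named facts (`def … : Prop`, nothing asserted),
consumed by the base-change-and-descend road of the BSD rank-`≤ 1` residual cell at an ADDITIVE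
prime (`Summits/BirchSwinnertonDyer/…/Theorems/ByReductionTypeAtTwoAdditiveCubicResolventDescent`),
where an elliptic curve `E/ℚ` with semistability defect `Φ = C₃` at `2` acquires GOOD reduction over
a cubic field `F` in which `2 = 𝔓³`.

THE CONFIGURATION. `F` a cubic number field with `d_F = d_K · f²`, `f ≠ 0`, for a quadratic number
field `K` (so `F/ℚ` is NOT Galois and `K = ℚ(√d_F)` is its quadratic resolvent — the tree's
`Literature.NumberTheory.CubicFields.not_isGalois_of_discr_eq_mul_sq`, `exists_resolventClosure`),
and `L ⊇ F, K` a number field of degree `6`, Galois over `ℚ`: then `L = F·K = F(√d_K)` is the normal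
closure of `F`, `Gal(L/ℚ) ≅ S₃`, `F = L^{C₂}`, `K = L^{C₃}` (Hasse 1930; Davenport–Heilbronn 1971 §6;
the tree's `CubicFields/CubicResolventClosure.lean`). The `S₃` BRAUER RELATION (Dokchitser–Dokchitser,
Ann. of Math. 172 (2010), §2.4, the `S₃` example: *"The submodule of `ℤ𝓗` of relations is generated
by … `Θ = 2S₃ + 1 − 2C₂ − C₃`"*; §1, Example with `E = X₁(11)`, `L = ℚ(∛m)`, `F = ℚ(μ₃, ∛m)`:
*"We have an equality of `Gal(ℚ̄/ℚ)`-representations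
`(Ind_{F/ℚ} 𝟙_F) ⊕ (𝟙_ℚ)^{⊕2} ≅ (Ind_{L/ℚ} 𝟙_L)^{⊕2} ⊕ (Ind_{ℚ(μ₃)/ℚ} 𝟙_{ℚ(μ₃)})`"* — there `F` is
the sextic and `L` the cubic field) reads, in this file's lettering,

  `Ind_{L/ℚ} 𝟙 ⊕ 𝟙 ⊕ 𝟙 ≅ Ind_{K/ℚ} 𝟙 ⊕ Ind_{F/ℚ} 𝟙 ⊕ Ind_{F/ℚ} 𝟙`   (permutation representations of `S₃`).

THE THREE PRINTED CONSEQUENCES recorded here (all for `W/ℚ` elliptic):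
* `LSeries_brauerS3` — Artin formalism: `L(E/L, s) · L(E/ℚ, s)² = L(E/K, s) · L(E/F, s)²` on the
  common half-plane of absolute convergence `Re s > 3/2` (Dokchitser–Dokchitser 2010, §2.1: *"By
  Artin formalism for `L`-functions, `∏_i L(A/L_i, s) = ∏_j L(A/L'_j, s)`"*), for Mathlib's
  Hasse–Weil `L`-series `WeierstrassCurve.LSeries` of the base changes (Euler products of the local
  factors of local minimal models; the local factor at `v` is that of `(V_ℓ E)^{I_v}`, and
  `L(s, Ind W) = L(s, W)` place by place).
* `DokchitserDokchitser2010.bsdQuotient_brauerS3_anyModel` — Thm. 2.3 (loc. cit.) for this relation: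
  if `Ш(E/ℚ)`, `Ш(E/K)`, `Ш(E/F)` are finite then so is `Ш(E/L)` and
  `BSD(E/L) · BSD(E/ℚ)² = BSD(E/K) · BSD(E/F)²` for the Birch–Swinnerton-Dyer quotients
  *"`BSD(A/K) = |Ш(A/K)| Reg(A/K) C(A/K) / (|A(K)_tors||A^t(K)_tors||Δ_K|^{dim A/2}) · ∏_{v real}
  ∫|ω| · ∏_{v cplx} 2∫ ω∧ω̄`"* (§2.1, statement 2.1 and Notation), on ARBITRARY models with
  Dokchitser–Dokchitser's `C(E/K, ω) = ∏ c_v |ω/ω_v°|_v` (the tree's `modifiedTamagawaProduct`), in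
  the currency of the tree's quadratic instance `Milne1972.bsdQuotient_baseChange_quadratic_anyModel`.
* `hasEntireLFunction_baseChange_cubic` / `hasEntireLFunction_baseChange_of_isGalois_six` — the
  entire continuation of `L(E/F, s)` for ANY cubic number field `F` (base change of the cuspidal
  automorphic representation of `E` — modularity, Breuil–Conrad–Diamond–Taylor 2001 — to a cyclic
  cubic field: Langlands 1980; to a NON-normal cubic field: Jacquet–Piatetski-Shapiro–Shalika 1981,
  *"Relèvement cubique non normal"*) and of `L(E/L, s)` for `L/ℚ` Galois of degree `6` (solvable:
  Langlands 1980 in two cyclic steps of prime degree / Arthur–Clozel 1989), the `TODO(general form)`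
  recorded under `hasEntireLFunction_baseChange_fixedField` (`AnalyticRankOverNumberField.lean`) for
  the two shapes the descent road needs.

What is deliberately NOT here: the regulator constants / `□` machinery of Dokchitser–Dokchitser
(only the exact, unconditional quotient relation of Thm. 2.3 is used); the `p`-primary refinement of Thm. 2.3
(finiteness of `Ш[p^∞]` only) — the consumer assumes finiteness of `Ш`; any claim about which primes
ramify in `F` (the consumer's reading «`2 = 𝔓³`» is a hypothesis there, not here).

## References
* T. Dokchitser, V. Dokchitser, *On the Birch–Swinnerton-Dyer quotients modulo squares*, Ann. of
  Math. 172 (2010) 567–596 (= arXiv:math/0610290, held): §1 Example (`X₁(11)` over `ℚ(∛m)`), §2.1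
  Conj. 2.1 / Notation / Thm. 2.3 and its proof, §2.4 the `S₃` example. [DokchitserDokchitserAnnals2010]
* J. S. Milne, *On the arithmetic of abelian varieties*, Invent. Math. 17 (1972) 177–190, §1 Thm. 1,
  §2 Prop. 6 (a). [Milne1972ArithmeticAV]; *Arithmetic Duality Theorems*, Thm. I.7.3. [MilneADT2006]
* R. P. Langlands, *Base change for GL(2)*, Ann. of Math. Stud. 96 (1980). [Langlands1980AMS96]
* J. Arthur, L. Clozel, *Simple algebras, base change, and the advanced theory of the trace formula*,
  Ann. of Math. Stud. 120 (1989). [ArthurClozelAMS120]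
* H. Jacquet, I. Piatetski-Shapiro, J. Shalika, *Relèvement cubique non normal*, C. R. Acad. Sci.
  Paris 292 (1981) 567–571. [JPSS1981Cubique]
* C. Breuil, B. Conrad, F. Diamond, R. Taylor, JAMS 14 (2001), Thm. A. [BCDTJAMS2001]
* J. Neukirch, *Algebraic Number Theory* (1999), VII (10.4)–(10.6) (Artin formalism). [NeukirchANT1999]
-/

noncomputable section

open scoped Classical

namespace Literature.NumberTheory.EllipticCurves

open WeierstrassCurve

/-- **Artin formalism for the `S₃` Brauer relation of a cubic field and its resolvent.** For `E/ℚ`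
elliptic (`W`), `K` quadratic, `F` cubic with `d_F = d_K f²` (`f ≠ 0`), and `L ⊇ F, K` Galois of
degree `6` over `ℚ` (so `L = F(√d_K)`, `Gal(L/ℚ) ≅ S₃`), the permutation-representation identity
`Ind_{L/ℚ}𝟙 ⊕ 𝟙² ≅ Ind_{K/ℚ}𝟙 ⊕ (Ind_{F/ℚ}𝟙)²` (Dokchitser–Dokchitser 2010, §2.4 the `S₃` example
`Θ = 2S₃ + 1 − 2C₂ − C₃`; §1 Example for `ℚ(∛m)`) gives, by Artin formalism (loc. cit. §2.1: *"By
Artin formalism for `L`-functions, `∏_i L(A/L_i,s) = ∏_j L(A/L'_j,s)`"*), the identity of Hasse–Weil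
`L`-series `L(E/L,s) · L(E/ℚ,s)² = L(E/K,s) · L(E/F,s)²` on the common half-plane of absolute
convergence `Re s > 3/2` (Mathlib's `WeierstrassCurve.LSeries` of the base changes). Named fact.
[cite: DokchitserDokchitserAnnals2010, §2.1 (Artin formalism) with §2.4, Example (G = S₃: Θ = 2S₃ + 1 − 2C₂ − C₃) and §1, Example (X₁(11) over ℚ(∛m))]
[cite: NeukirchANT1999, VII (10.4) (iv) and (10.6) (inductivity of Artin L-series)] -/
def LSeries_brauerS3 : Prop :=
  ∀ (W : WeierstrassCurve ℚ) [W.IsElliptic]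
    (K : Type) [Field K] [NumberField K], Module.finrank ℚ K = 2 →
    ∀ (F : Type) [Field F] [NumberField F], Module.finrank ℚ F = 3 →
    ∀ (f : ℤ), f ≠ 0 → NumberField.discr F = NumberField.discr K * f ^ 2 →
    ∀ (L : Type) [Field L] [NumberField L] [Algebra F L] [Algebra K L],
      Module.finrank ℚ L = 6 → IsGalois ℚ L →
    ∀ s : ℂ, (3 / 2 : ℝ) < s.re →
      (W.baseChange L).LSeries s * W.LSeries s ^ 2 =
        (W.baseChange K).LSeries s * (W.baseChange F).LSeries s ^ 2

/-- **`L(E/F, s)` is entire for every cubic number field `F`** (`E/ℚ` elliptic): `E` is modular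
(Breuil–Conrad–Diamond–Taylor 2001, Thm. A), and the base change of its cuspidal automorphic
representation to `GL₂` over a cubic field exists — Langlands, *Base change for GL(2)* (1980) for a
cyclic cubic field, Jacquet–Piatetski-Shapiro–Shalika, *Relèvement cubique non normal* (1981) for a
non-normal one — with local base change compatible with the local correspondence at every place
(Arthur–Clozel 1989, Ch. 1 §6), so that its (entire) standard `L`-function is the Hasse–Weil
`L`-function `L(E/F, s)` of Mathlib (`WeierstrassCurve.LSeries (W.baseChange F)`). In the tree's
carrier: `(W.baseChange F).HasEntireLFunction`. The cubic case of the `TODO(general form)` under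
`hasEntireLFunction_baseChange_fixedField`. Named fact.
[cite: JPSS1981Cubique, Théorème (base change to a non-normal cubic extension)]
[cite: Langlands1980AMS96, Ch. 2 (cyclic base change of prime degree)]
[cite: ArthurClozelAMS120, Ch. 3 Thm. 4.2 and Ch. 1 §6] [cite: BCDTJAMS2001, Theorem A] -/
def hasEntireLFunction_baseChange_cubic : Prop :=
  ∀ (W : WeierstrassCurve ℚ) [W.IsElliptic] (F : Type) [Field F] [NumberField F],
    Module.finrank ℚ F = 3 → (W.baseChange F).HasEntireLFunction

/-- **`L(E/L, s)` is entire for `L/ℚ` Galois of degree `6`** (`E/ℚ` elliptic): `Gal(L/ℚ)` (`≅ S₃`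
or `C₆`) is solvable, so the base change of the cuspidal automorphic representation of `E`
(modularity, BCDT 2001) to `GL₂` over `L` exists by two cyclic base changes of prime degree
(Langlands 1980; Arthur–Clozel 1989, Ch. 3 Thm. 4.2 for cyclic prime degree, whence solvable), with
local–global compatibility, and its standard `L`-function `L(E/L, s)` is entire. In the tree's
carrier: `(W.baseChange L).HasEntireLFunction`. The degree-`6` case of the `TODO(general form)`
under `hasEntireLFunction_baseChange_fixedField`. Named fact.
[cite: Langlands1980AMS96, Ch. 2 (cyclic base change of prime degree, iterated for solvable extensions)]
[cite: ArthurClozelAMS120, Ch. 3 Thm. 4.2 and Thm. 5.1] [cite: BCDTJAMS2001, Theorem A] -/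
def hasEntireLFunction_baseChange_of_isGalois_six : Prop :=
  ∀ (W : WeierstrassCurve ℚ) [W.IsElliptic] (L : Type) [Field L] [NumberField L],
    Module.finrank ℚ L = 6 → IsGalois ℚ L → (W.baseChange L).HasEntireLFunction

namespace DokchitserDokchitser2010

/-- **Dokchitser–Dokchitser 2010, Thm. 2.3, for the `S₃` relation of a cubic field and its
resolvent, on ARBITRARY models.** Thm. 2.3 (Ann. of Math. 172, §2.1): *"Let `A/K` be an abelian
variety, and let `L_i, L'_j` be finite extensions of `K` satisfying
`⊕_i Ind_{L_i/K} 𝟙 ≅ ⊕_j Ind_{L'_j/K} 𝟙`. Suppose that `Ш(A/L_i)`, `Ш(A/L'_j)` are finite. Then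
[statement 2.2] (b) holds"*, i.e. the PROVED compatibility *"`∏_i BSD(A/L_i) = ∏_j BSD(A/L'_j)`"* of the
Birch–Swinnerton-Dyer quotients of statement 2.1 *"`BSD(A/K) = |Ш(A/K)| Reg(A/K) C(A/K) /
(|A(K)_tors||A^t(K)_tors||Δ_K|^{dim A/2}) ∏_{v real} ∫_{A(K_v)}|ω| ∏_{v cplx} 2∫_{A(K_v)} ω∧ω̄`"*
(*"independent of the choice of `ω` by the product formula"*; `C(E/K) = ∏_{v∤∞} c_v|ω/ω_v°|_v`, §1
Notation); proof: *"`BSD_p(W_{F/K}(A)) = BSD_p(A/F)` provided that `Ш(A/F)[p^∞]` is finite ([MilO]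
§1)"*, `X = ∏ W_{L_i/K}(A)` and `Y = ∏ W_{L'_j/K}(A)` are isogenous ([MilO] §2 Prop. 6a), and *"the
invariance of the Birch–Swinnerton-Dyer quotient under isogenies ([CasVIII], [TatC] and [MilA] Thm.
7.3, Remark 7.4)"* — which also transports finiteness of `Ш` between `X` and `Y`. Applied with
`A = E/ℚ` and the `S₃` relation `Ind_{L/ℚ}𝟙 ⊕ 𝟙² ≅ Ind_{K/ℚ}𝟙 ⊕ (Ind_{F/ℚ}𝟙)²` (§2.4, the `S₃`
example `Θ = 2S₃ + 1 − 2C₂ − C₃`; §1 Example for the pure cubic fields `ℚ(∛m)`): for `K` quadratic,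
`F` cubic with `d_F = d_K f²`, `L ⊇ F, K` Galois of degree `6`, and ANY models `V_F, V_K, V_L` of
`E_F, E_K, E_L` (differentials `ω_V`, `C(·, ω_V) = V.modifiedTamagawaProduct`, `Ω(·, ω_V) =
V.bsdPeriod` including `|Δ|^{-1/2}`, `Reg = V.regulator`, `#tors = V.torsionOrder`; over `ℚ` the
globally minimal `W` with `BSD(E/ℚ) = W.bsdRHS`, exactly the currency of
`Milne1972.bsdQuotient_baseChange_quadratic_anyModel`): if `Ш(E/ℚ), Ш(E/K), Ш(E/F)` are finite then
`Ш(E/L)` is finite (`Ш(X) = Ш(E/L) × Ш(E/ℚ)²`, `Ш(Y) = Ш(E/K) × Ш(E/F)²`, `X ∼ Y`) and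
**`BSD(E/L) · BSD(E/ℚ)² = BSD(E/K) · BSD(E/F)²`**. Named fact.
[cite: DokchitserDokchitserAnnals2010, §2.1 statement 2.1, Notation and Thm. 2.3 with its proof; §2.4, Example (G = S₃); §1, Example (X₁(11) over ℚ(∛m))]
[cite: Milne1972ArithmeticAV, §1 Thm. 1 and §2 Prop. 6 (a)] [cite: MilneADT2006, Thm. I.7.3 and Remark I.7.4] -/
def bsdQuotient_brauerS3_anyModel : Prop :=
  ∀ (W : WeierstrassCurve ℚ) [W.IsElliptic] [W.IsGloballyMinimal]
    (K : Type) [Field K] [NumberField K], Module.finrank ℚ K = 2 →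
    ∀ (F : Type) [Field F] [NumberField F], Module.finrank ℚ F = 3 →
    ∀ (f : ℤ), f ≠ 0 → NumberField.discr F = NumberField.discr K * f ^ 2 →
    ∀ (L : Type) [Field L] [NumberField L] [Algebra F L] [Algebra K L],
      Module.finrank ℚ L = 6 → IsGalois ℚ L →
    ∀ (VF : WeierstrassCurve F) [VF.IsElliptic],
      (∃ C : _root_.WeierstrassCurve.VariableChange F, C • W.baseChange F = VF) →
    ∀ (VK : WeierstrassCurve K) [VK.IsElliptic],
      (∃ C : _root_.WeierstrassCurve.VariableChange K, C • W.baseChange K = VK) →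
    ∀ (VL : WeierstrassCurve L) [VL.IsElliptic],
      (∃ C : _root_.WeierstrassCurve.VariableChange L, C • W.baseChange L = VL) →
      W.ShaFinite → VK.ShaFinite → VF.ShaFinite →
        VL.ShaFinite ∧
          ((VL.shaOrder : ℝ) * VL.regulator * VL.bsdPeriod * (VL.modifiedTamagawaProduct : ℝ) /
              (VL.torsionOrder : ℝ) ^ 2) * W.bsdRHS ^ 2 =
            ((VK.shaOrder : ℝ) * VK.regulator * VK.bsdPeriod * (VK.modifiedTamagawaProduct : ℝ) /
              (VK.torsionOrder : ℝ) ^ 2) *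
            ((VF.shaOrder : ℝ) * VF.regulator * VF.bsdPeriod * (VF.modifiedTamagawaProduct : ℝ) /
              (VF.torsionOrder : ℝ) ^ 2) ^ 2

end DokchitserDokchitser2010

end Literature.NumberTheory.EllipticCurves

end
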